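import Literature.Analysis.FluidPDE.NSLocalAnalyticityRadiusSupBound
import HarnessLib

/-!
# QuietScarPocketDoorUnitSliceCore — door S31 «QuietScarPocketDoor», plate P2a = PF-b′:
# **`unitFloatingSliceCore_holds : UnitFloatingSliceCore`** (ns-s29-p2 g3; text nsreg-p1 g25 `r29/Sketch31B.lean`
# 74974e2dd69b4349, nsreg-lit g20 tree note 09:21:56Z / DRAFT-CHECK PASS 09:43:00Z; planner-of-record endorsement 09:47:42Z)

PF-b′: the FLOATING-SLICE twin of the tree's small-data unit-scale Bradshaw–Grujić–Kukavica core WITH the sup bound,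
`Literature.Analysis.FluidPDE.BGK2015.exists_small_unitScale_extension_norm_le` (NSLocalAnalyticityRadiusSupBound): same
absolute constants `ε₀, C₀, K`, same hypotheses (window `(−δ, 12²)`, ball `B(x₁, 12)`, the three smallnesses), but the
holomorphic extension with its bound is read off at EVERY slice `s ∈ [1, 144)` instead of the fixed slice `s = 1`.

PROOF = the assembly of the tree theorem verbatim (cut-off `cutoff12`, `ε`-regularity sup bound
`exists_forall_norm_le_of_small` on `Ico (1/16) 144 × B(x₁, 11)`, the datum of the localised Oseen representation, the
contour Picard scheme `IsSchemeRun` with `ρ₀ = 1/(16Λ)`), run on the FLOATING pair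
`(s₀, t₁) = (s − 1/2, min (s + 1/2) ((s + 144)/2))` and evaluated at `t := s ∈ (s₀, t₁)`
(`BGK2015.exists_differentiableOn_region_of_fixedPoint_norm_le`): every callee is already parametrised by the run pair
(`Icc s₀ t₁ ⊆ Ioo (−δ) 144`, `t₁ − s₀ ≤ 1`), the scheme's smallness conditions are MONOTONE in `√(t₁ − s₀) ≤ 1`, and the
region `region x₁ c s₀ s` has the same radius `c√(1/2) = 1/(4C₀)` as the tree's `region x₁ c (1/2) 1`.  No existing
declaration is touched (nsreg-lit g20: the Literature-lane window surgery of r29/PF-AID.md §D is thereby avoided).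
[BradshawGrujicKukavica2015 Thm. 2.3, §3–§4, (4.9) p. 19 — the printed induction is causal: nothing after the evaluation
slice is used (nsreg-lit §R157 (b)).]

WHAT THIS IS NOT: a unit-scale analytic lemma in support of LEG F / PF-b of door S31; PF-b″ (`TerminalUniformRadius` by
scaling + cover) is a separate file; nothing about door S31 itself, 0056 or NS regularity is proved here (0056 OPEN).
-/

noncomputable section

open MeasureTheory Set Function Filter Metric Real
open _root_.Topology
open scoped ENNReal NNReal ContDiff Laplacian InnerProductSpace RealInnerProductSpace
open Literature.Analysis.FunctionSpaces.EuclideanSpace (complexify complexify_apply norm_complexify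
  complexify_injective continuous_complexify)
open Literature.Analysis.FluidPDE

set_option linter.dupNamespace false

namespace Summit.NavierStokesRegularity.NavierStokesRegularity.Theorems.QuietScarPocketDoor

/-- PF-b′ (support, S/M — copy-generalise of `BGK2015.exists_small_unitScale_extension_norm_le`):
the small-data unit-scale core WITH the sup bound, evaluated at a FLOATING slice `s ∈ [1, 144)`
instead of the fixed slice `1`.  Same absolute constants, same hypotheses (window `(−δ, 12²)`,
ball `B(x₁, 12)`, the three smallnesses); conclusion for every `s ∈ Ico 1 (12²)`. -/
def UnitFloatingSliceCore : Prop :=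
    ∃ ε₀ C₀ K : ℝ, 0 < ε₀ ∧ 0 < C₀ ∧ 0 < K ∧
    ∀ (x₁ : EuclideanSpace ℝ (Fin 3)) ⦃δ : ℝ⦄, 0 < δ →
      ∀ ⦃u : ℝ → EuclideanSpace ℝ (Fin 3) → EuclideanSpace ℝ (Fin 3)⦄
        ⦃p : ℝ → EuclideanSpace ℝ (Fin 3) → ℝ⦄,
        ContDiffOn ℝ ∞ (uncurry u) (Ioo (-δ) ((12 : ℝ) ^ 2) ×ˢ ball x₁ 12) →
        ContDiffOn ℝ ∞ (uncurry p) (Ioo (-δ) ((12 : ℝ) ^ 2) ×ˢ ball x₁ 12) →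
        (∀ t ∈ Ioo (-δ) ((12 : ℝ) ^ 2), ∀ x ∈ ball x₁ 12,
          deriv (fun s => u s x) t + convect (u t) (u t) x = Δ (u t) x - gradient (p t) x) →
        (∀ t ∈ Ioo (-δ) ((12 : ℝ) ^ 2), ∀ x ∈ ball x₁ 12, VectorCalculus.divergence (u t) x = 0) →
        (∀ t ∈ Ioo (-δ) ((12 : ℝ) ^ 2),
          eLpNorm (u t) 3 (volume.restrict (ball x₁ 12)) ≤ ENNReal.ofReal ε₀) →
        (∀ t ∈ Ioo (-δ) ((12 : ℝ) ^ 2),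
          eLpNorm (p t) (ENNReal.ofReal (3 / 2)) (volume.restrict (ball x₁ 12)) ≤
            ENNReal.ofReal ε₀) →
        (∫⁻ t in Ioo 0 ((12 : ℝ) ^ 2),
          eLpNorm (fun x => Real.sqrt (frobeniusNormSq (fderiv ℝ (u t) x))) 2
            (volume.restrict (ball x₁ 12)) ^ (2 : ℝ) ≤ ENNReal.ofReal (ε₀ ^ 2)) →
        ∀ s ∈ Ico (1 : ℝ) ((12 : ℝ) ^ 2),
        ∃ U : EuclideanSpace ℂ (Fin 3) → EuclideanSpace ℂ (Fin 3),
          DifferentiableOn ℂ U (localComplexTube x₁ 1 (1 / (4 * C₀))) ∧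
          (∀ z ∈ localComplexTube x₁ 1 (1 / (4 * C₀)), ‖U z‖ ≤ K) ∧
          ∀ x ∈ ball x₁ 1, U (complexify x) = complexify (u s x)

set_option maxHeartbeats 1600000 in -- as in the tree's `BGK2015.exists_small_unitScale_extension_norm_le` (same assembly)
open BGK2015 in
/-- **PF-b′ · `UnitFloatingSliceCore` holds** (the tree's `BGK2015.exists_small_unitScale_extension_norm_le` re-run on the
floating pair `(s − 1/2, min (s + 1/2) ((s + 144)/2))`, evaluation slice `s ∈ [1, 144)`; constants `ε₀, C₀, K = ρ₀` as there). -/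
theorem unitFloatingSliceCore_holds : UnitFloatingSliceCore := by
  classical
  -- absolute constants
  obtain ⟨ε₁, K, hε₁, hK, hE⟩ := exists_forall_norm_le_of_small
  obtain ⟨C_B, hCB0, hCB⟩ := exists_norm_oseenDuhamel_le_mul (E := EuclideanSpace ℝ (Fin 3))
  obtain ⟨Cf, hCf0, hCf⟩ := exists_norm_integral_oseenKernelC_flat_le_local (n := 2)
  obtain ⟨L₀, hL₀0, hL₀, hLip⟩ := exists_bump2_lipschitz
  obtain ⟨C_H, hCH0, hCH⟩ := exists_abs_deriv_stepH_le
  obtain ⟨L₁, L₂, hL₁0, hL₂0, hcut⟩ := exists_cutoff12_bounds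
  obtain ⟨A, hA0, hA⟩ := exists_norm_locDataC_le hL₁0 hL₂0
  set Vf : ℝ := (volume (closedBall (0 : EuclideanSpace ℝ (Fin 3)) 9)).toReal ^ (1 / 3 : ℝ) with hVf
  have hVf0 : 0 ≤ Vf := Real.rpow_nonneg ENNReal.toReal_nonneg _
  -- the aperture and the complex radius
  set c : ℝ := min 1 (1 / (4 * L₀)) with hc
  have hc0 : 0 < c := lt_min one_pos (by positivity)
  have hc1 : c ≤ 1 := min_le_left _ _
  have hcL : c * L₀ ≤ 1 / 4 := by
    have h : c ≤ 1 / (4 * L₀) := min_le_right _ _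
    calc c * L₀ ≤ 1 / (4 * L₀) * L₀ := mul_le_mul_of_nonneg_right h hL₀0.le
      _ = 1 / 4 := by field_simp
  set Λ : ℝ := (1 + c * 1 * L₀ * (1 + 2 * C_H)) * Cf with hΛ
  have hΛ0 : 0 < Λ := by positivity
  set ρ₀ : ℝ := 1 / (16 * Λ) with hρ₀
  have hρ₀0 : 0 < ρ₀ := by positivity
  have hΛρ : Λ * ρ₀ = 1 / 16 := by rw [hρ₀]; field_simp
  -- the size threshold
  set m : ℝ := min 1 (min (7 * ρ₀ / (24 * (A + 1))) (min (ρ₀ / (2 * (1 + 2 * C_B))) (1 / (16 * C_B * (1 + 2 * C_B)))))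
    with hm
  have hm0 : 0 < m := lt_min one_pos (lt_min (by positivity) (lt_min (by positivity) (by positivity)))
  have hm1 : m ≤ 1 := min_le_left _ _
  have hmA : 3 * (A + 1) * m ≤ 7 * ρ₀ / 8 := by
    have h : m ≤ 7 * ρ₀ / (24 * (A + 1)) := (min_le_right _ _).trans (min_le_left _ _)
    rw [le_div_iff₀ (by positivity)] at h
    linarith
  have hmρ : 2 * (1 + 2 * C_B) * m ≤ ρ₀ := by
    have h : m ≤ ρ₀ / (2 * (1 + 2 * C_B)) := ((min_le_right _ _).trans (min_le_right _ _)).trans (min_le_left _ _)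
    rw [le_div_iff₀ (by positivity)] at h
    linarith
  have hmB : 16 * C_B * (1 + 2 * C_B) * m ≤ 1 := by
    have h : m ≤ 1 / (16 * C_B * (1 + 2 * C_B)) := ((min_le_right _ _).trans (min_le_right _ _)).trans (min_le_right _ _)
    rw [le_div_iff₀ (by positivity)] at h
    linarith
  -- the smallness parameter
  set ε₀ : ℝ := min ε₁ (min 1 (min ((m / K) ^ 2) (m / (Vf + 1)))) with hε₀
  have hε₀0 : 0 < ε₀ := lt_min hε₁ (lt_min one_pos (lt_min (by positivity) (by positivity)))
  have hε₀1 : ε₀ ≤ ε₁ := min_le_left _ _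
  have hKε : K * Real.sqrt ε₀ ≤ m := by
    have h : ε₀ ≤ (m / K) ^ 2 := ((min_le_right _ _).trans (min_le_right _ _)).trans (min_le_left _ _)
    have h2 : Real.sqrt ε₀ ≤ m / K := by
      rw [Real.sqrt_le_left (by positivity)]; exact h
    calc K * Real.sqrt ε₀ ≤ K * (m / K) := mul_le_mul_of_nonneg_left h2 hK.le
      _ = m := by field_simp
  have hVε : Vf * ε₀ ≤ m := by
    have h : ε₀ ≤ m / (Vf + 1) := ((min_le_right _ _).trans (min_le_right _ _)).trans (min_le_right _ _)
    rw [le_div_iff₀ (by positivity)] at h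
    rw [show Vf * ε₀ = ε₀ * (Vf + 1) - ε₀ by ring]
    linarith [hε₀0.le]
  -- the output constant
  set κ : ℝ := c * Real.sqrt (1 - 1 / 2) with hκ
  have hκ0 : 0 < κ := by positivity
  set C₀ : ℝ := 1 / (4 * κ) with hC₀
  have hC₀0 : 0 < C₀ := by positivity
  have hC₀κ : 1 / (4 * C₀) = κ := by rw [hC₀]; field_simp
  refine ⟨ε₀, C₀, ρ₀, hε₀0, hC₀0, hρ₀0, ?_⟩
  intro x₁ δ hδ u p hu hp hns hdiv hu3 hp32 hgrad s hs
  -- the solution and the cut-off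
  have hsol : IsSmallCylinderSolution x₁ δ 12 ε₀ u p := .of_hypotheses hu hp hns hdiv hu3 hp32 hgrad
  have hcyl : IsCylinderSolution x₁ δ 12 u p := hsol.toIsCylinderSolution
  have hχ : IsLocCutoff x₁ 12 (cutoff12 x₁) := isLocCutoff_cutoff12 x₁
  have hL₁ : ∀ y, ‖gradient (cutoff12 x₁) y‖ ≤ L₁ := fun y => (hcut x₁ y).1
  have hL₂ : ∀ y, |(Δ (cutoff12 x₁)) y| ≤ L₂ := fun y => (hcut x₁ y).2
  -- times
  -- the FLOATING run pair `(s₀, t₁) = (s − 1/2, min (s + 1/2) ((s + 144)/2))`, evaluation slice `s`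
  set s₀ : ℝ := s - 1 / 2 with hs₀_def
  set t₁ : ℝ := min (s + 1 / 2) ((s + (12 : ℝ) ^ 2) / 2) with ht₁_def
  have hs1 : (1 : ℝ) ≤ s := hs.1
  have hs2 : s < (12 : ℝ) ^ 2 := hs.2
  have ht₁a : t₁ ≤ s + 1 / 2 := min_le_left _ _
  have ht₁b : t₁ ≤ (s + (12 : ℝ) ^ 2) / 2 := min_le_right _ _
  have hs₀s : s₀ < s := by rw [hs₀_def]; linarith
  have hst₁ : s < t₁ := lt_min (by linarith) (by linarith)
  have hI : Icc s₀ t₁ ⊆ Ioo (-δ) ((12 : ℝ) ^ 2) := fun τ hτ =>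
    ⟨by linarith [hτ.1, hs₀_def], by linarith [hτ.2]⟩
  have hs₀ : -δ < s₀ := by rw [hs₀_def]; linarith
  have ht₁ : t₁ < (12 : ℝ) ^ 2 := by linarith
  have hT : t₁ - s₀ ≤ 1 := by rw [hs₀_def]; linarith
  have hsq0 : 0 ≤ Real.sqrt (t₁ - s₀) := Real.sqrt_nonneg _
  have hsq : Real.sqrt (t₁ - s₀) ≤ 1 := by rw [Real.sqrt_le_one]; linarith
  have hss₀ : s - s₀ = 1 - 1 / 2 := by rw [hs₀_def]; ring
  -- `M_u = K√ε₀`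
  set Mu : ℝ := K * Real.sqrt ε₀ with hMu
  have hMu0 : 0 ≤ Mu := by positivity
  have hMum : Mu ≤ m := hKε
  have hMu1 : Mu ≤ 1 := hMum.trans hm1
  have hMu2 : Mu ^ 2 ≤ Mu := by
    calc Mu ^ 2 = Mu * Mu := sq Mu
      _ ≤ Mu * 1 := mul_le_mul_of_nonneg_left hMu1 hMu0
      _ = Mu := mul_one _
  have hMub : ∀ τ ∈ Icc s₀ t₁, ∀ y ∈ ball x₁ 11, ‖u τ y‖ ≤ Mu := by
    intro τ hτ y hy
    have h := hE hε₀0 hε₀1 x₁ hδ (by norm_num : (1 : ℝ) ≤ 12) hu hp hns hdiv hu3 hp32 τ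
      ⟨by linarith [hτ.1, hs₀_def], by linarith [hτ.2]⟩ y (by norm_num; exact hy)
    exact h
  -- `M_p = |B̄₉|^{1/3} ε₀`
  set Mp : ℝ := Vf * ε₀ with hMp
  have hMp0 : 0 ≤ Mp := by positivity
  have hMpm : Mp ≤ m := hVε
  have hMpb : ∀ τ ∈ Icc s₀ t₁, ∫ y in closedBall x₁ 9, |p τ y| ≤ Mp := fun τ hτ =>
    integral_abs_le_of_eLpNorm_three_halves (continuousOn_pressure_slice hcyl (hI hτ)) hε₀0.le (hp32 τ (hI hτ))
  -- the datum sizes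
  set D₀ : ℝ := Mu + C_B * Mu ^ 2 * 2 with hD₀
  have hD₀0 : 0 ≤ D₀ := by positivity
  have hD₀le : D₀ ≤ (1 + 2 * C_B) * m := by
    have h1 : C_B * Mu ^ 2 * 2 ≤ C_B * Mu * 2 :=
      mul_le_mul_of_nonneg_right (mul_le_mul_of_nonneg_left hMu2 hCB0.le) zero_le_two
    calc D₀ = Mu + C_B * Mu ^ 2 * 2 := rfl
      _ ≤ Mu + C_B * Mu * 2 := by linarith
      _ = (1 + 2 * C_B) * Mu := by ring
      _ ≤ (1 + 2 * C_B) * m := mul_le_mul_of_nonneg_left hMum (by positivity)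
  set D₀' : ℝ := A * (Mu + Mu ^ 2 + Mp) with hD₀'
  have hD₀'0 : 0 ≤ D₀' := by positivity
  have hD₀'le : D₀' ≤ 7 * ρ₀ / 8 := by
    have h1 : Mu + Mu ^ 2 + Mp ≤ 3 * m := by linarith
    calc D₀' ≤ A * (3 * m) := mul_le_mul_of_nonneg_left h1 hA0
      _ = 3 * (A + 1) * m - 3 * m := by ring
      _ ≤ 3 * (A + 1) * m := by linarith [hm0.le]
      _ ≤ 7 * ρ₀ / 8 := hmA
  -- bounds of `v` on the slab
  have hMv : ∀ τ ∈ Ioo s₀ t₁, ∀ y, ‖locVelocity (cutoff12 x₁) u τ y‖ ≤ Mu := fun τ hτ y =>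
    norm_locVelocity_le' hχ hMub (Ioo_subset_Icc_self hτ) y
  have hCB1 : ∀ {u v : ℝ → EuclideanSpace ℝ (Fin 3) → EuclideanSpace ℝ (Fin 3)} {s t Mu Mv : ℝ}, s < t →
      0 ≤ Mu → 0 ≤ Mv → (∀ τ ∈ Ioo s t, ∀ y, ‖u τ y‖ ≤ Mu) → (∀ τ ∈ Ioo s t, ∀ y, ‖v τ y‖ ≤ Mv) → ∀ x,
      ‖oseenDuhamel 1 s u v t x‖ ≤ C_B * Mu * Mv * (1 : ℝ) ^ (-(1 / 2 : ℝ)) * (2 * Real.sqrt (t - s)) :=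
    fun hst hMu hMv hu hv x => hCB one_pos hst hMu hMv hu hv x
  -- the scheme datum
  have hDat : IsSchemeDatum x₁ c s₀ t₁ D₀ D₀' (locData x₁ 12 (cutoff12 x₁) u p s₀)
      (locDataC x₁ 12 (cutoff12 x₁) u p s₀) := by
    refine ⟨aestronglyMeasurable_uncurry_locData hcyl hχ hs₀ ht₁, hD₀0, fun t ht x => ?_, hD₀'0,
      fun t ht ζ hζ => ?_, fun t ht => ?_, fun t ht x => ?_⟩
    · have h := norm_locData_le hcyl hχ hs₀ ht₁ hCB1 hMu0 hMv ht x
      refine h.trans ?_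
      have hsqt : Real.sqrt (t - s₀) ≤ 1 := by rw [Real.sqrt_le_one]; linarith [ht.2]
      rw [hD₀]
      have : C_B * Mu ^ 2 * (2 * Real.sqrt (t - s₀)) ≤ C_B * Mu ^ 2 * 2 := by
        have h0 : 0 ≤ C_B * Mu ^ 2 := by positivity
        calc C_B * Mu ^ 2 * (2 * Real.sqrt (t - s₀)) ≤ C_B * Mu ^ 2 * (2 * 1) := by gcongr
          _ = C_B * Mu ^ 2 * 2 := by ring
      linarith
    · obtain ⟨x, y, rfl, hx, -, hyψ, hyκ, -⟩ := mem_region hζ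
      have hy1 : ‖y‖ ≤ Real.sqrt (t - s₀) := by
        refine hyψ.le.trans ?_
        have hA1 : c * Real.sqrt (t - s₀) ≤ Real.sqrt (t - s₀) := mul_le_of_le_one_left (Real.sqrt_nonneg _) hc1
        calc c * Real.sqrt (t - s₀) * bump2 x₁ x ≤ Real.sqrt (t - s₀) * bump2 x₁ x :=
              mul_le_mul_of_nonneg_right hA1 (bump2_nonneg _ _)
          _ ≤ Real.sqrt (t - s₀) := mul_le_of_le_one_right (Real.sqrt_nonneg _) (bump2_le_one _ _)
      have hy2 : ‖y‖ ≤ 1 := by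
        refine hyκ.le.trans ?_
        have hsqt : Real.sqrt (t - s₀) ≤ 1 := by rw [Real.sqrt_le_one]; linarith [ht.2]
        calc c * Real.sqrt (t - s₀) ≤ 1 * 1 := by gcongr
          _ = 1 := one_mul _
      exact hA hcyl hχ hL₁ hL₂ hI hT hMu0 hMub hMp0 hMpb ht hx hy1 hy2
    · refine differentiableOn_locDataC hcyl hχ hI hT hL₁ hMu0 hMub ht (isOpen_region _ _ _ _) fun ζ hζ => ?_
      obtain ⟨x, y, rfl, hx, -, hyψ, hyκ, -⟩ := mem_region hζ
      have hsqt : Real.sqrt (t - s₀) ≤ 1 := by rw [Real.sqrt_le_one]; linarith [ht.2]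
      refine ⟨x, y, rfl, hx, hyψ.le.trans ?_, hyκ.le.trans ?_⟩
      · have hA1 : c * Real.sqrt (t - s₀) ≤ Real.sqrt (t - s₀) := mul_le_of_le_one_left (Real.sqrt_nonneg _) hc1
        calc c * Real.sqrt (t - s₀) * bump2 x₁ x ≤ Real.sqrt (t - s₀) * bump2 x₁ x :=
              mul_le_mul_of_nonneg_right hA1 (bump2_nonneg _ _)
          _ ≤ Real.sqrt (t - s₀) := mul_le_of_le_one_right (Real.sqrt_nonneg _) (bump2_le_one _ _)
      · calc c * Real.sqrt (t - s₀) ≤ 1 * 1 := by gcongr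
          _ = 1 := one_mul _
    · exact locDataC_complexify hcyl hχ hs₀ ht.1 (ht.2.trans ht₁) x
  -- the run of the scheme
  have hRun : IsSchemeRun x₁ c s₀ t₁ D₀ D₀' (locData x₁ 12 (cutoff12 x₁) u p s₀)
      (locDataC x₁ 12 (cutoff12 x₁) u p s₀) C_B Cf L₀ C_H ρ₀ := by
    refine ⟨hDat, hCB0, hCB1, ?_, hCf0, hCf, hL₀0, hL₀, hLip, hCH0, hCH, hs₀s.trans hst₁, hc0, hc1, ?_, ?_, ?_, ?_⟩
    · -- `C_B (2D₀) 2√(t₁ - s₀) ≤ 1/4`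
      calc C_B * (2 * D₀) * (2 * Real.sqrt (t₁ - s₀)) ≤ C_B * (2 * D₀) * (2 * 1) := by gcongr
        _ = 4 * C_B * D₀ := by ring
        _ ≤ 4 * C_B * ((1 + 2 * C_B) * m) := by gcongr
        _ = (16 * C_B * (1 + 2 * C_B) * m) / 4 := by ring
        _ ≤ 1 / 4 := by linarith
    · calc c * L₀ * Real.sqrt (t₁ - s₀) ≤ c * L₀ * 1 := by gcongr
        _ = c * L₀ := mul_one _
        _ ≤ 1 / 4 := hcL
    · linarith
    · have h1 : (1 + c * Real.sqrt (t₁ - s₀) * L₀ * (1 + 2 * C_H)) * Cf * ρ₀ ^ 2 * (2 * Real.sqrt (t₁ - s₀)) ≤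
          (1 + c * 1 * L₀ * (1 + 2 * C_H)) * Cf * ρ₀ ^ 2 * (2 * 1) := by gcongr
      have h2 : (1 + c * 1 * L₀ * (1 + 2 * C_H)) * Cf * ρ₀ ^ 2 * (2 * 1) = 2 * (Λ * ρ₀) * ρ₀ := by rw [hΛ]; ring
      rw [h2, hΛρ] at h1
      linarith
    · have h1 : (1 + c * Real.sqrt (t₁ - s₀) * L₀ * (1 + 2 * C_H)) * Cf * ρ₀ * (2 * Real.sqrt (t₁ - s₀)) ≤
          (1 + c * 1 * L₀ * (1 + 2 * C_H)) * Cf * ρ₀ * (2 * 1) := by gcongr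
      have h2 : (1 + c * 1 * L₀ * (1 + 2 * C_H)) * Cf * ρ₀ * (2 * 1) = 2 * (Λ * ρ₀) := by rw [hΛ]; ring
      rw [h2, hΛρ] at h1
      linarith
  -- the localised velocity is the bounded fixed point
  have hvm : AEStronglyMeasurable (uncurry (locVelocity (cutoff12 x₁) u))
      ((volume : Measure (ℝ × EuclideanSpace ℝ (Fin 3))).restrict (Ioo s₀ t₁ ×ˢ univ)) :=
    aestronglyMeasurable_uncurry_locVelocity hcyl hχ hI
  have hvb : ∀ t ∈ Ioo s₀ t₁, ∀ x, ‖locVelocity (cutoff12 x₁) u t x‖ ≤ 2 * D₀ := by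
    intro t ht x
    refine (hMv t ht x).trans ?_
    rw [hD₀]
    have : 0 ≤ C_B * Mu ^ 2 * 2 := by positivity
    linarith
  have hvfix : ∀ t ∈ Ioo s₀ t₁, ∀ x, locVelocity (cutoff12 x₁) u t x =
      locData x₁ 12 (cutoff12 x₁) u p s₀ t x -
        oseenDuhamel 1 s₀ (locVelocity (cutoff12 x₁) u) (locVelocity (cutoff12 x₁) u) t x :=
    fun t ht x => locVelocity_eq_locData_sub hcyl hχ hs₀ ht.1 (ht.2.trans ht₁) x
  obtain ⟨U, hU, hUbd, hUres⟩ := exists_differentiableOn_region_of_fixedPoint_norm_le hRun hvm hvb hvfix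
    (t := s) ⟨hs₀s, hst₁⟩
  -- conclusion on the local tube over `B(x₁, 1)`
  have htube : localComplexTube x₁ 1 (1 / (4 * C₀)) ⊆ region x₁ c s₀ s := by
    rw [hC₀κ]
    show localComplexTube x₁ 1 κ ⊆ profileRegion fun z => (c * Real.sqrt (s - s₀)) * bump2 x₁ z
    rw [hss₀]
    exact localComplexTube_subset_profileRegion x₁ κ
  refine ⟨U, hU.mono htube, fun z hz => hUbd z (htube hz), fun x hx => ?_⟩
  have hxreg : complexify x ∈ region x₁ c s₀ s := by
    show complexify x ∈ profileRegion fun z => (c * Real.sqrt (s - s₀)) * bump2 x₁ z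
    rw [hss₀, complexify_mem_profileRegion_iff, bump2_eq_one_of_mem (ball_subset_closedBall hx), mul_one]
    exact hκ0
  rw [hUres x hxreg, locVelocity_apply, hχ.eq_one x ?_, one_smul]
  norm_num
  exact (closedBall_subset_closedBall (by norm_num)) (ball_subset_closedBall hx)


end Summit.NavierStokesRegularity.NavierStokesRegularity.Theorems.QuietScarPocketDoor

end
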